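import Literature.MathematicalPhysics.QuantumFieldTheory.ConformalBootstrap3D.BlockZSeries
import Literature.MathematicalPhysics.QuantumFieldTheory.ConformalBootstrap3D.MixedBlockCoefficientExistence
import Mathlib.Topology.Algebra.InfiniteSum.Real
import Mathlib.Topology.Algebra.InfiniteSum.NatInt
import HarnessLib

/-!
# The `z`-series of the MIXED-channel blocks `g^{Δ₁₂,Δ₃₄}_{Δ,ℓ}` at every real point of the square

`BlockZSeries.lean` does this for `Δ₁₂ = Δ₃₄ = 0`. With the general-`(a,b)` coefficients `hrCoeffAB`
(`MixedBlockCoefficients.lean`, Dolan–Osborn 2004 §3 eqs. (3.9)–(3.12), `a = -Δ₁₂/2`, `b = Δ₃₄/2`) and the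
identification (E_ab) (`MixedBlockCoefficientExistence.lean`: every solution of the typed coefficient system off
the accidental degeneracies is `hrMonomialCoeffAB a b Δ ℓ`), the same argument gives, at every regular
`(Δ, ℓ)` and every `0 < x, y < 1`, for EVERY `g` with `IsConformalBlock3D Δ₁₂ Δ₃₄ Δ ℓ g`:

* `IsConformalBlock3D.hasSum_hrLevelAB` — the LEVEL series
  `g(x,y) = Σ_{n ≥ 0} [ Σ_{j ≤ ℓ+n} (A_{n,j}(a,b)/λ_ℓ) 𝒫_{Δ+n,j}(x,y) ]` (each level a finite sum; valid for
  all `(Δ₁₂, Δ₃₄)`, in particular for the sign-indefinite family `gmm = g^{Δ_σε,Δ_σε}` of `⟨σεσε⟩`, sum rule 3)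
  — from antidiagonal summation of the absolutely convergent double power series, no positivity used;
* `IsConformalBlock3D.hasSum_hrZTermAB` — for `Δ₁₂ = -Δ₃₄` (`a = b`, the reflection-positive ordering,
  the family `gpm = g^{-Δ_σε,Δ_σε}` of `⟨εσσε⟩`, sum rules 4–5) the DOUBLE series over `(n, j)` with
  NON-NEGATIVE terms (`hrCoeffAB_self_nonneg`), hence `sum_hrZTermAB_le` (every finite partial sum is a lower
  bound), `nonneg_offdiag_of_neg_eq`, and the termwise action of real point functionals
  `hasSum_pointFunctional_crossF_hrZAB` (`φ[F^{s}_{±}[g]] = Σ (A_{n,j}(a,a)/λ_ℓ) φ[F^{s}_{±}[𝒫_{Δ+n,j}]]`) — the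
  input shape of the point-functional certificate rules for the odd-channel halves of sum rules 4–5.

Positivity source in print: Hartman–Jain–Kundu, JHEP 05 (2016) 099 §4.4 (blocks with `Δ₁₂ = -Δ₃₄` have a
positive `z, z̄` expansion; "not true without the prefactor" in `ρ`); Fitzpatrick–Kaplan–Poland–Simmons-Duffin,
JHEP 12 (2013) 004 App. A (`Δ₁₂ = 0`). Nothing here at non-regular `(Δ, ℓ)`; for `ℓ ≥ 1` and `ab ≠ 0` the
mixed blocks have a POLE at the unitarity bound (`hrCoeffAB_one_pred`), so no closed-cell statement at
`Δ = ℓ+1` is attempted. [cite: DolanOsborn2004, §3 eqs. (3.9)–(3.12)]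
-/

namespace Literature.MathematicalPhysics.QuantumFieldTheory.ConformalBootstrap3D

open Finset Set

/-! ### Antidiagonal sums of the `(a,b)` array -/

/-- For `N ≥ ℓ`: `Σ_{m+n=N} k_{mn}(a,b) x^m y^n = Σ_{j ≤ N} (A_{N-ℓ,j}(a,b)/λ_ℓ) (xy)^{(N-j)/2} 𝒫_j(x,y)`.
[cite: DolanOsborn2004, §3 eqs. (3.10)–(3.11)] -/
theorem sum_antidiagonal_hrMonomialCoeffAB (a b Δ : ℝ) {ℓ N : ℕ} (hN : ℓ ≤ N) (x y : ℝ) :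
    ∑ p ∈ antidiagonal N, hrMonomialCoeffAB a b Δ ℓ p * x ^ p.1 * y ^ p.2 =
      ∑ j ∈ range (N + 1), hrCoeffAB a b Δ ℓ (N - ℓ) j / legendreLam ℓ *
        ((x * y) ^ ((N - j) / 2) * zLegendre j x y) := by
  calc ∑ p ∈ antidiagonal N, hrMonomialCoeffAB a b Δ ℓ p * x ^ p.1 * y ^ p.2
      = ∑ p ∈ antidiagonal N, ∑ j ∈ range (N + 1),
          hrCoeffAB a b Δ ℓ (N - ℓ) j / legendreLam ℓ * (legendreArrDeg N j p * x ^ p.1 * y ^ p.2) := by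
        refine sum_congr rfl fun p hp => ?_
        rw [mem_antidiagonal] at hp
        rw [hrMonomialCoeffAB_eq_slice a b Δ ℓ hp hN]
        unfold hrSliceAB
        rw [sum_mul, sum_mul]
        exact sum_congr rfl fun j _ => by ring
    _ = ∑ j ∈ range (N + 1), hrCoeffAB a b Δ ℓ (N - ℓ) j / legendreLam ℓ *
          ∑ p ∈ antidiagonal N, legendreArrDeg N j p * x ^ p.1 * y ^ p.2 := by
        rw [sum_comm]
        exact sum_congr rfl fun j _ => by rw [mul_sum]
    _ = _ := by
        refine sum_congr rfl fun j hj => ?_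
        rw [sum_antidiagonal_legendreArrDeg_mul_pow]
        split_ifs with hc
        · rfl
        · have hzero : hrCoeffAB a b Δ ℓ (N - ℓ) j = 0 := by
            apply hrCoeffAB_eq_zero_of_not_inDescendantRange
            intro hr
            apply hc
            have hjN : j < N + 1 := Finset.mem_range.mp hj
            unfold InDescendantRange at hr
            omega
          rw [hzero, zero_div, zero_mul, zero_mul]

/-! ### The `(a,b)` `z`-series terms -/

/-- The `(n, j)` term of the `z`-series of the Dolan–Osborn-normalised block `g^{Δ₁₂,Δ₃₄}_{Δ,ℓ}` at a real
point: `(A_{n,j}(a,b)/λ_ℓ) 𝒫_{Δ+n,j}(x,y)`. [cite: DolanOsborn2004, §3 eqs. (3.10)–(3.12)] -/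
noncomputable def hrZTermAB (a b Δ : ℝ) (ℓ : ℕ) (x y : ℝ) (q : ℕ × ℕ) : ℝ :=
  hrCoeffAB a b Δ ℓ q.1 q.2 / legendreLam ℓ * zMono (Δ + (q.1 : ℝ)) q.2 x y

/-- `a = b = 0`: the Hogervorst–Rychkov terms of `BlockZSeries`. [cite: DolanOsborn2004, §3 eq. (3.11)] -/
theorem hrZTermAB_zero_zero (Δ : ℝ) (ℓ : ℕ) (x y : ℝ) : hrZTermAB 0 0 Δ ℓ x y = hrZTerm Δ ℓ x y := by
  funext q
  unfold hrZTermAB hrZTerm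
  rw [hrCoeffAB_zero_zero]

/-- For `a = b` the terms are non-negative above the unitarity bound (`A_{n,j}(a,a) ≥ 0`, `λ_ℓ > 0`,
`𝒫 ≥ 0`). [cite: DolanOsborn2004, §3 eq. (3.11)] -/
theorem hrZTermAB_self_nonneg {Δ : ℝ} {ℓ : ℕ} (a : ℝ) (hΔ : unitarityBound3D ℓ < Δ) {x y : ℝ}
    (hx : 0 ≤ x) (hy : 0 ≤ y) (q : ℕ × ℕ) : 0 ≤ hrZTermAB a a Δ ℓ x y q :=
  mul_nonneg (div_nonneg (hrCoeffAB_self_nonneg a hΔ _ _) (legendreLam_pos ℓ).le) (zMono_nonneg _ _ hx hy)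

/-- The level-`n` finite sum `Σ_{j ≤ ℓ+n} (A_{n,j}(a,b)/λ_ℓ) 𝒫_{Δ+n,j}(x,y)`. [cite: DolanOsborn2004, §3 eq. (3.10)] -/
noncomputable def hrLevelAB (a b Δ : ℝ) (ℓ : ℕ) (x y : ℝ) (n : ℕ) : ℝ :=
  ∑ j ∈ range (ℓ + n + 1), hrZTermAB a b Δ ℓ x y (n, j)

/-- Degree-indexed terms `T(N, j) := (xy)^{(Δ-ℓ)/2} (A_{N-ℓ,j}(a,b)/λ_ℓ) (xy)^{(N-j)/2} 𝒫_j(x,y)` for `N ≥ ℓ`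
(else `0`). [folklore] -/
noncomputable def hrZTermDegAB (a b Δ : ℝ) (ℓ : ℕ) (x y : ℝ) (q : ℕ × ℕ) : ℝ :=
  if ℓ ≤ q.1 then (x * y) ^ ((Δ - (ℓ : ℝ)) / 2) *
    (hrCoeffAB a b Δ ℓ (q.1 - ℓ) q.2 / legendreLam ℓ * ((x * y) ^ ((q.1 - q.2) / 2) * zLegendre q.2 x y))
  else 0

/-- `T(N, j) ≥ 0` for `a = b` above the bound, `x, y ≥ 0`. [folklore] -/
theorem hrZTermDegAB_self_nonneg {Δ : ℝ} {ℓ : ℕ} (a : ℝ) (hΔ : unitarityBound3D ℓ < Δ) {x y : ℝ}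
    (hx : 0 ≤ x) (hy : 0 ≤ y) (q : ℕ × ℕ) : 0 ≤ hrZTermDegAB a a Δ ℓ x y q := by
  unfold hrZTermDegAB
  split_ifs
  · refine mul_nonneg (Real.rpow_nonneg (mul_nonneg hx hy) _) (mul_nonneg ?_ ?_)
    · exact div_nonneg (hrCoeffAB_self_nonneg a hΔ _ _) (legendreLam_pos ℓ).le
    · exact mul_nonneg (pow_nonneg (mul_nonneg hx hy) _) (zLegendre_nonneg _ hx hy)
  · exact le_rfl

/-- `T(N, j) = 0` for `j > N`. [folklore] -/
theorem hrZTermDegAB_eq_zero_of_lt (a b Δ : ℝ) (ℓ : ℕ) (x y : ℝ) {N j : ℕ} (h : N < j) :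
    hrZTermDegAB a b Δ ℓ x y (N, j) = 0 := by
  unfold hrZTermDegAB
  split_ifs with hN
  · simp only
    rw [hrCoeffAB_eq_zero_of_lt a b Δ (show ℓ + (N - ℓ) < j by omega), zero_div, zero_mul, mul_zero]
  · rfl

/-- Row sums of `T`: `Σ_{j ≤ N} T(N,j) = (xy)^{(Δ-ℓ)/2} Σ_{m+n=N} k_{mn}(a,b) x^m y^n`.
[cite: DolanOsborn2004, §3 eqs. (3.10)–(3.11)] -/
theorem sum_range_hrZTermDegAB (a b Δ : ℝ) (ℓ : ℕ) (x y : ℝ) (N : ℕ) :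
    ∑ j ∈ range (N + 1), hrZTermDegAB a b Δ ℓ x y (N, j) =
      (x * y) ^ ((Δ - (ℓ : ℝ)) / 2) *
        ∑ p ∈ antidiagonal N, hrMonomialCoeffAB a b Δ ℓ p * x ^ p.1 * y ^ p.2 := by
  by_cases hN : ℓ ≤ N
  · rw [sum_antidiagonal_hrMonomialCoeffAB a b Δ hN, mul_sum]
    exact sum_congr rfl fun j _ => by unfold hrZTermDegAB; rw [if_pos hN]
  · rw [not_le] at hN
    have h1 : ∑ j ∈ range (N + 1), hrZTermDegAB a b Δ ℓ x y (N, j) = 0 :=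
      sum_eq_zero fun j _ => by unfold hrZTermDegAB; rw [if_neg (by simp only; omega)]
    have h2 : ∑ p ∈ antidiagonal N, hrMonomialCoeffAB a b Δ ℓ p * x ^ p.1 * y ^ p.2 = 0 :=
      sum_eq_zero fun p hp => by
        rw [mem_antidiagonal] at hp
        rw [hrMonomialCoeffAB_eq_zero_of_lt a b Δ ℓ (by omega), zero_mul, zero_mul]
    rw [h1, h2, mul_zero]

/-- The shift `N = ℓ + n`: `T(n+ℓ, j) = (A_{n,j}(a,b)/λ_ℓ) 𝒫_{Δ+n,j}(x,y)` (`0 < x, y`).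
[cite: DolanOsborn2004, §3 eq. (3.10)] -/
theorem hrZTermDegAB_shift {a b Δ : ℝ} {ℓ : ℕ} {x y : ℝ} (hx : 0 < x) (hy : 0 < y) (n j : ℕ) :
    hrZTermDegAB a b Δ ℓ x y (n + ℓ, j) = hrZTermAB a b Δ ℓ x y (n, j) := by
  unfold hrZTermDegAB hrZTermAB zMono
  rw [if_pos (Nat.le_add_left ℓ n)]
  simp only [Nat.add_sub_cancel]
  by_cases hr : InDescendantRange ℓ n j
  · obtain ⟨_, hj, hpar⟩ := hr
    have hxy : 0 < x * y := mul_pos hx hy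
    have ht : 2 * ((n + ℓ - j) / 2) = n + ℓ - j := by omega
    have hj' : j ≤ n + ℓ := by omega
    have htR : (((n + ℓ - j) / 2 : ℕ) : ℝ) * 2 = (n : ℝ) + ℓ - j := by
      have h1 : (((2 * ((n + ℓ - j) / 2) : ℕ) : ℝ)) = ((n + ℓ - j : ℕ) : ℝ) := by rw [ht]
      rw [Nat.cast_sub hj'] at h1
      push_cast at h1
      linarith
    have hpow : (x * y) ^ ((Δ - (ℓ : ℝ)) / 2) * (x * y) ^ ((n + ℓ - j) / 2) =
        (x * y) ^ ((Δ + (n : ℝ) - (j : ℝ)) / 2) := by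
      rw [← Real.rpow_natCast (x * y) ((n + ℓ - j) / 2), ← Real.rpow_add hxy]
      congr 1
      linarith
    calc (x * y) ^ ((Δ - (ℓ : ℝ)) / 2) *
          (hrCoeffAB a b Δ ℓ n j / legendreLam ℓ * ((x * y) ^ ((n + ℓ - j) / 2) * zLegendre j x y))
        = hrCoeffAB a b Δ ℓ n j / legendreLam ℓ *
            ((x * y) ^ ((Δ - (ℓ : ℝ)) / 2) * (x * y) ^ ((n + ℓ - j) / 2) * zLegendre j x y) := by
          ring
      _ = _ := by rw [hpow]
  · rw [hrCoeffAB_eq_zero_of_not_inDescendantRange a b Δ hr, zero_div, zero_mul, zero_mul, mul_zero]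

/-- The shifted row sums are the level sums: `Σ_{j ≤ n+ℓ} T(n+ℓ, j) = hrLevelAB … n`. [folklore] -/
theorem sum_range_hrZTermDegAB_shift {a b Δ : ℝ} {ℓ : ℕ} {x y : ℝ} (hx : 0 < x) (hy : 0 < y) (n : ℕ) :
    ∑ j ∈ range (n + ℓ + 1), hrZTermDegAB a b Δ ℓ x y (n + ℓ, j) = hrLevelAB a b Δ ℓ x y n := by
  unfold hrLevelAB
  rw [show ℓ + n + 1 = n + ℓ + 1 by ring]
  exact sum_congr rfl fun j _ => hrZTermDegAB_shift hx hy n j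

/-! ### The identification at a real point: level series (all `Δ₁₂, Δ₃₄`) -/

/-- **The level series of a genuine mixed-channel block at every real point of the square.** At a regular
`(Δ, ℓ)` every `g` with `IsConformalBlock3D Δ₁₂ Δ₃₄ Δ ℓ g` satisfies, for `0 < x, y < 1`,
`g(x,y) = Σ_n Σ_{j ≤ ℓ+n} (A_{n,j}(a,b)/λ_ℓ) 𝒫_{Δ+n,j}(x,y)`, `a = -Δ₁₂/2`, `b = Δ₃₄/2`, as a convergent series
over the LEVEL `n` (no sign condition: valid for the `⟨σεσε⟩` family too). Proof: (α)+(U)+(E_ab) identify the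
double-power-series coefficients with `hrMonomialCoeffAB a b Δ ℓ`; sum along antidiagonals; drop the `ℓ`
vanishing rows. [cite: DolanOsborn2004, §3 eqs. (3.9)–(3.12)] -/
theorem IsConformalBlock3D.hasSum_hrLevelAB {Δ₁₂ Δ₃₄ Δ : ℝ} {ℓ : ℕ} {g : ℝ → ℝ → ℝ}
    (hΔ : unitarityBound3D ℓ < Δ) (hreg : ¬ accidentalDegeneracy3D Δ ℓ)
    (h : IsConformalBlock3D Δ₁₂ Δ₃₄ Δ ℓ g) {x y : ℝ} (hx : x ∈ Ioo (0 : ℝ) 1) (hy : y ∈ Ioo (0 : ℝ) 1) :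
    HasSum (hrLevelAB (-Δ₁₂ / 2) (Δ₃₄ / 2) Δ ℓ x y) (g x y) := by
  have hregpt : IsRegularPoint3D Δ ℓ := ⟨ne_of_gt hΔ, hreg⟩
  obtain ⟨k, K, hS, hsym, hlead, hg, hC⟩ :=
    (isConformalBlock3D_iff_above_of_isRegularPoint3D hregpt).mp h
  have hk : SatisfiesCoeffCasimir (-Δ₁₂ / 2) (Δ₃₄ / 2) Δ ℓ k := satisfiesCoeffCasimir_of_casimirEq3D hS hg hC
  have hkeq : k = hrMonomialCoeffAB (-Δ₁₂ / 2) (Δ₃₄ / 2) Δ ℓ := hk.eq_hrMonomialCoeffAB hΔ hreg hsym hlead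
  have h1 := (hS.hasSum_antidiagonal hx.1.le hx.2 hy.1.le hy.2).mul_left
    ((x * y) ^ ((Δ - (ℓ : ℝ)) / 2))
  rw [← hg x y hx hy, hkeq] at h1
  have hfun : (fun N : ℕ => (x * y) ^ ((Δ - (ℓ : ℝ)) / 2) *
      ∑ p ∈ antidiagonal N, hrMonomialCoeffAB (-Δ₁₂ / 2) (Δ₃₄ / 2) Δ ℓ p * x ^ p.1 * y ^ p.2) =
      fun N : ℕ => ∑ j ∈ range (N + 1), hrZTermDegAB (-Δ₁₂ / 2) (Δ₃₄ / 2) Δ ℓ x y (N, j) :=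
    funext fun N => (sum_range_hrZTermDegAB _ _ Δ ℓ x y N).symm
  rw [hfun] at h1
  -- drop the first `ℓ` rows (they vanish) and shift `N = n + ℓ`
  have h2 := (hasSum_nat_add_iff' ℓ).mpr h1
  have hzero : ∑ i ∈ range ℓ, ∑ j ∈ range (i + 1), hrZTermDegAB (-Δ₁₂ / 2) (Δ₃₄ / 2) Δ ℓ x y (i, j) = 0 :=
    sum_eq_zero fun i hi => sum_eq_zero fun j _ => by
      unfold hrZTermDegAB
      rw [if_neg (by simp only; have := mem_range.mp hi; omega)]
  rw [hzero, sub_zero] at h2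
  have hfun' : (fun n : ℕ => ∑ j ∈ range (n + ℓ + 1), hrZTermDegAB (-Δ₁₂ / 2) (Δ₃₄ / 2) Δ ℓ x y (n + ℓ, j)) =
      hrLevelAB (-Δ₁₂ / 2) (Δ₃₄ / 2) Δ ℓ x y :=
    funext fun n => sum_range_hrZTermDegAB_shift hx.1 hy.1 n
  rw [hfun'] at h2
  exact h2

/-- The same as an equation: `g(x,y) = Σ' n, hrLevelAB a b Δ ℓ x y n`. [cite: DolanOsborn2004, §3 eq. (3.10)] -/
theorem IsConformalBlock3D.eq_tsum_hrLevelAB {Δ₁₂ Δ₃₄ Δ : ℝ} {ℓ : ℕ} {g : ℝ → ℝ → ℝ}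
    (hΔ : unitarityBound3D ℓ < Δ) (hreg : ¬ accidentalDegeneracy3D Δ ℓ)
    (h : IsConformalBlock3D Δ₁₂ Δ₃₄ Δ ℓ g) {x y : ℝ} (hx : x ∈ Ioo (0 : ℝ) 1) (hy : y ∈ Ioo (0 : ℝ) 1) :
    g x y = ∑' n : ℕ, hrLevelAB (-Δ₁₂ / 2) (Δ₃₄ / 2) Δ ℓ x y n :=
  (h.hasSum_hrLevelAB hΔ hreg hx hy).tsum_eq.symm

/-! ### The reflection-positive ordering `Δ₁₂ = -Δ₃₄` (`a = b`): non-negative double series -/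

/-- **The `z`-series of a genuine block with `Δ₁₂ = -Δ₃₄` at every real point of the square.** At a regular
`(Δ, ℓ)` every `g` with `IsConformalBlock3D Δ₁₂ Δ₃₄ Δ ℓ g`, `Δ₁₂ = -Δ₃₄`, satisfies for `0 < x, y < 1`
`g(x,y) = Σ_{(n,j)} (A_{n,j}(a,a)/λ_ℓ) 𝒫_{Δ+n,j}(x,y)`, `a = Δ₃₄/2`, as a convergent double series of
NON-NEGATIVE terms — the reflection-positive family (`gpm = g^{-Δ_σε,Δ_σε}` of `⟨εσσε⟩` has `Δ₁₂ = -Δ_σε`,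
`Δ₃₄ = Δ_σε`, `a = Δ_σε/2`). [cite: DolanOsborn2004, §3 eqs. (3.9)–(3.12)] -/
theorem IsConformalBlock3D.hasSum_hrZTermAB {Δ₁₂ Δ₃₄ Δ : ℝ} {ℓ : ℕ} {g : ℝ → ℝ → ℝ}
    (hΔ : unitarityBound3D ℓ < Δ) (hreg : ¬ accidentalDegeneracy3D Δ ℓ) (hab : Δ₁₂ = -Δ₃₄)
    (h : IsConformalBlock3D Δ₁₂ Δ₃₄ Δ ℓ g) {x y : ℝ} (hx : x ∈ Ioo (0 : ℝ) 1) (hy : y ∈ Ioo (0 : ℝ) 1) :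
    HasSum (hrZTermAB (Δ₃₄ / 2) (Δ₃₄ / 2) Δ ℓ x y) (g x y) := by
  have hregpt : IsRegularPoint3D Δ ℓ := ⟨ne_of_gt hΔ, hreg⟩
  obtain ⟨k, K, hS, hsym, hlead, hg, hC⟩ :=
    (isConformalBlock3D_iff_above_of_isRegularPoint3D hregpt).mp h
  have h12 : -Δ₁₂ / 2 = Δ₃₄ / 2 := by rw [hab]; ring
  have hk : SatisfiesCoeffCasimir (Δ₃₄ / 2) (Δ₃₄ / 2) Δ ℓ k := by
    have := satisfiesCoeffCasimir_of_casimirEq3D hS hg hC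
    rwa [h12] at this
  have hkeq : k = hrMonomialCoeffAB (Δ₃₄ / 2) (Δ₃₄ / 2) Δ ℓ := hk.eq_hrMonomialCoeffAB hΔ hreg hsym hlead
  have h1 := (hS.hasSum_antidiagonal hx.1.le hx.2 hy.1.le hy.2).mul_left
    ((x * y) ^ ((Δ - (ℓ : ℝ)) / 2))
  rw [← hg x y hx hy, hkeq] at h1
  have hfun : (fun N : ℕ => (x * y) ^ ((Δ - (ℓ : ℝ)) / 2) *
      ∑ p ∈ antidiagonal N, hrMonomialCoeffAB (Δ₃₄ / 2) (Δ₃₄ / 2) Δ ℓ p * x ^ p.1 * y ^ p.2) =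
      fun N : ℕ => ∑ j ∈ range (N + 1), hrZTermDegAB (Δ₃₄ / 2) (Δ₃₄ / 2) Δ ℓ x y (N, j) :=
    funext fun N => (sum_range_hrZTermDegAB _ _ Δ ℓ x y N).symm
  rw [hfun] at h1
  have h2 : HasSum (hrZTermDegAB (Δ₃₄ / 2) (Δ₃₄ / 2) Δ ℓ x y) (g x y) :=
    hasSum_prod_of_hasSum_rows (hrZTermDegAB_self_nonneg _ hΔ hx.1.le hy.1.le)
      (fun N j hNj => hrZTermDegAB_eq_zero_of_lt _ _ Δ ℓ x y hNj) h1
  have hinj : Function.Injective (fun q : ℕ × ℕ => (q.1 + ℓ, q.2)) := by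
    intro p q hpq
    simp only [Prod.mk.injEq, add_left_inj] at hpq
    exact Prod.ext hpq.1 hpq.2
  have hoff : ∀ q : ℕ × ℕ, q ∉ Set.range (fun q : ℕ × ℕ => (q.1 + ℓ, q.2)) →
      hrZTermDegAB (Δ₃₄ / 2) (Δ₃₄ / 2) Δ ℓ x y q = 0 := by
    intro q hq
    have hlt : q.1 < ℓ := by
      by_contra hge
      rw [not_lt] at hge
      exact hq ⟨(q.1 - ℓ, q.2), Prod.ext (Nat.sub_add_cancel hge) rfl⟩
    unfold hrZTermDegAB
    rw [if_neg (by omega)]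
  have h3 := (hinj.hasSum_iff hoff).mpr h2
  have hfun' : (hrZTermDegAB (Δ₃₄ / 2) (Δ₃₄ / 2) Δ ℓ x y ∘ fun q : ℕ × ℕ => (q.1 + ℓ, q.2)) =
      hrZTermAB (Δ₃₄ / 2) (Δ₃₄ / 2) Δ ℓ x y :=
    funext fun q => hrZTermDegAB_shift hx.1 hy.1 q.1 q.2
  rw [hfun'] at h3
  exact h3

/-- As an equation: `g(x,y) = Σ' (A_{n,j}(a,a)/λ_ℓ) 𝒫_{Δ+n,j}(x,y)`. [cite: DolanOsborn2004, §3 eq. (3.10)] -/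
theorem IsConformalBlock3D.eq_tsum_hrZTermAB {Δ₁₂ Δ₃₄ Δ : ℝ} {ℓ : ℕ} {g : ℝ → ℝ → ℝ}
    (hΔ : unitarityBound3D ℓ < Δ) (hreg : ¬ accidentalDegeneracy3D Δ ℓ) (hab : Δ₁₂ = -Δ₃₄)
    (h : IsConformalBlock3D Δ₁₂ Δ₃₄ Δ ℓ g) {x y : ℝ} (hx : x ∈ Ioo (0 : ℝ) 1) (hy : y ∈ Ioo (0 : ℝ) 1) :
    g x y = ∑' q : ℕ × ℕ, hrZTermAB (Δ₃₄ / 2) (Δ₃₄ / 2) Δ ℓ x y q :=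
  (h.hasSum_hrZTermAB hΔ hreg hab hx hy).tsum_eq.symm

/-- **Every finite partial sum is a lower bound** (`Δ₁₂ = -Δ₃₄`; all terms non-negative).
[cite: DolanOsborn2004, §3 eq. (3.11)] -/
theorem IsConformalBlock3D.sum_hrZTermAB_le {Δ₁₂ Δ₃₄ Δ : ℝ} {ℓ : ℕ} {g : ℝ → ℝ → ℝ}
    (hΔ : unitarityBound3D ℓ < Δ) (hreg : ¬ accidentalDegeneracy3D Δ ℓ) (hab : Δ₁₂ = -Δ₃₄)
    (h : IsConformalBlock3D Δ₁₂ Δ₃₄ Δ ℓ g) {x y : ℝ} (hx : x ∈ Ioo (0 : ℝ) 1) (hy : y ∈ Ioo (0 : ℝ) 1)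
    (F : Finset (ℕ × ℕ)) : ∑ q ∈ F, hrZTermAB (Δ₃₄ / 2) (Δ₃₄ / 2) Δ ℓ x y q ≤ g x y :=
  sum_le_hasSum F (fun q _ => hrZTermAB_self_nonneg _ hΔ hx.1.le hy.1.le q)
    (h.hasSum_hrZTermAB hΔ hreg hab hx hy)

/-- In particular a genuine block with `Δ₁₂ = -Δ₃₄` is non-negative at every real point of the square
(regular `(Δ, ℓ)`). [cite: DolanOsborn2004, §3 eq. (3.11)] -/
theorem IsConformalBlock3D.nonneg_offdiag_of_neg_eq {Δ₁₂ Δ₃₄ Δ : ℝ} {ℓ : ℕ} {g : ℝ → ℝ → ℝ}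
    (hΔ : unitarityBound3D ℓ < Δ) (hreg : ¬ accidentalDegeneracy3D Δ ℓ) (hab : Δ₁₂ = -Δ₃₄)
    (h : IsConformalBlock3D Δ₁₂ Δ₃₄ Δ ℓ g) {x y : ℝ} (hx : x ∈ Ioo (0 : ℝ) 1) (hy : y ∈ Ioo (0 : ℝ) 1) :
    0 ≤ g x y := by
  simpa using h.sum_hrZTermAB_le hΔ hreg hab hx hy ∅

/-- The diagonal special case: `x^{Δ}/λ_ℓ ≤ g(x,x)` — the level-zero term (`A_{0,ℓ} = 1`, `𝒫_{Δ,ℓ}(x,x) = x^Δ`).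
For the mixed reflection-positive family this replaces `BlockDiagonalEnclosure.rpow_div_le_diag`.
[cite: DolanOsborn2004, §3 eq. (3.13)] -/
theorem IsConformalBlock3D.rpow_div_le_diag_of_neg_eq {Δ₁₂ Δ₃₄ Δ : ℝ} {ℓ : ℕ} {g : ℝ → ℝ → ℝ}
    (hΔ : unitarityBound3D ℓ < Δ) (hreg : ¬ accidentalDegeneracy3D Δ ℓ) (hab : Δ₁₂ = -Δ₃₄)
    (h : IsConformalBlock3D Δ₁₂ Δ₃₄ Δ ℓ g) {x : ℝ} (hx : x ∈ Ioo (0 : ℝ) 1) :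
    x ^ Δ / legendreLam ℓ ≤ g x x := by
  have := h.sum_hrZTermAB_le hΔ hreg hab hx hx {(0, ℓ)}
  rw [sum_singleton] at this
  unfold hrZTermAB at this
  simp only [hrCoeffAB_zero_self, Nat.cast_zero, add_zero] at this
  rw [zMono_diag _ _ hx.1] at this
  simpa [div_eq_inv_mul, mul_comm] using this

/-! ### Point functionals on the reflection-positive mixed family -/

/-- **Termwise action on the `(a,a)` `z`-series.** For a point-evaluation functional `φ` with nodes in the open
square and a genuine block `g` with `Δ₁₂ = -Δ₃₄` at a regular `(Δ, ℓ)`: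
`φ[F^{s}_{sign}[g]] = Σ_{(n,j)} (A_{n,j}(a,a)/λ_ℓ) φ[F^{s}_{sign}[𝒫_{Δ+n,j}]]`, `a = Δ₃₄/2`.
[cite: DolanOsborn2004, §3 eqs. (3.10)–(3.12)] -/
theorem hasSum_pointFunctional_crossF_hrZAB {n : ℕ} (w z zb : Fin n → ℝ)
    (hz : ∀ k, z k ∈ Ioo (0 : ℝ) 1) (hzb : ∀ k, zb k ∈ Ioo (0 : ℝ) 1) (s sign : ℝ) {Δ₁₂ Δ₃₄ Δ : ℝ} {ℓ : ℕ}
    {g : ℝ → ℝ → ℝ} (hΔ : unitarityBound3D ℓ < Δ) (hreg : ¬ accidentalDegeneracy3D Δ ℓ) (hab : Δ₁₂ = -Δ₃₄)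
    (h : IsConformalBlock3D Δ₁₂ Δ₃₄ Δ ℓ g) :
    HasSum (fun q : ℕ × ℕ => hrCoeffAB (Δ₃₄ / 2) (Δ₃₄ / 2) Δ ℓ q.1 q.2 / legendreLam ℓ *
        pointFunctional w z zb (crossF s sign (zMono (Δ + (q.1 : ℝ)) q.2)))
      (pointFunctional w z zb (crossF s sign g)) := by
  have hpt : ∀ x y : ℝ, x ∈ Ioo (0 : ℝ) 1 → y ∈ Ioo (0 : ℝ) 1 →
      HasSum (fun q : ℕ × ℕ => (fun x' y' => hrCoeffAB (Δ₃₄ / 2) (Δ₃₄ / 2) Δ ℓ q.1 q.2 / legendreLam ℓ *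
        zMono (Δ + (q.1 : ℝ)) q.2 x' y') x y) (g x y) :=
    fun x y hx hy => h.hasSum_hrZTermAB hΔ hreg hab hx hy
  have hF := evaluationContinuous_pointFunctional w z zb hz hzb (ℕ × ℕ) _ _
    (fun x y hx hy => hasSum_crossF s sign hpt hx hy)
  have hfun : (fun q : ℕ × ℕ => pointFunctional w z zb (crossF s sign
      (fun x' y' => hrCoeffAB (Δ₃₄ / 2) (Δ₃₄ / 2) Δ ℓ q.1 q.2 / legendreLam ℓ *
        zMono (Δ + (q.1 : ℝ)) q.2 x' y'))) =
      fun q : ℕ × ℕ => hrCoeffAB (Δ₃₄ / 2) (Δ₃₄ / 2) Δ ℓ q.1 q.2 / legendreLam ℓ *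
        pointFunctional w z zb (crossF s sign (zMono (Δ + (q.1 : ℝ)) q.2)) := by
    funext q
    have hc : crossF s sign (fun x' y' => hrCoeffAB (Δ₃₄ / 2) (Δ₃₄ / 2) Δ ℓ q.1 q.2 / legendreLam ℓ *
        zMono (Δ + (q.1 : ℝ)) q.2 x' y') =
        fun x' y' => hrCoeffAB (Δ₃₄ / 2) (Δ₃₄ / 2) Δ ℓ q.1 q.2 / legendreLam ℓ *
          crossF s sign (zMono (Δ + (q.1 : ℝ)) q.2) x' y' :=
      funext fun x' => funext fun y' => crossF_const_mul s sign _ _ x' y'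
    rw [hc]
    have hsm : (fun x' y' => hrCoeffAB (Δ₃₄ / 2) (Δ₃₄ / 2) Δ ℓ q.1 q.2 / legendreLam ℓ *
        crossF s sign (zMono (Δ + (q.1 : ℝ)) q.2) x' y') =
        (hrCoeffAB (Δ₃₄ / 2) (Δ₃₄ / 2) Δ ℓ q.1 q.2 / legendreLam ℓ) •
          crossF s sign (zMono (Δ + (q.1 : ℝ)) q.2) := by
      funext x' y'
      simp only [Pi.smul_apply, smul_eq_mul]
    rw [hsm, map_smul, smul_eq_mul]
  rw [hfun] at hF
  exact hF

/-- **Positivity of a point functional on the reflection-positive mixed family from termwise positivity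
(finite head + non-negative tail).** If `φ[F^{s}_{sign}[𝒫_{Δ+n,j}]] ≥ 0` for every `(n,j) ∉ F` on the descendant
range and the head `Σ_{(n,j)∈F} (A_{n,j}(a,a)/λ_ℓ) φ[F^{s}_{sign}[𝒫_{Δ+n,j}]] ≥ 0`, then
`0 ≤ φ[F^{s}_{sign}[g]]` for every genuine `g` with `Δ₁₂ = -Δ₃₄` at the regular point `(Δ, ℓ)` — the
verification rule for the odd-channel halves of the σ–ε sum rules 4 (`sign = -1`) and 5 (`sign = +1`).
[cite: DolanOsborn2004, §3 eq. (3.11)] -/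
theorem pointFunctional_crossF_nonneg_of_termwise_AB {n : ℕ} (w z zb : Fin n → ℝ)
    (hz : ∀ k, z k ∈ Ioo (0 : ℝ) 1) (hzb : ∀ k, zb k ∈ Ioo (0 : ℝ) 1) (s sign : ℝ) {Δ₁₂ Δ₃₄ Δ : ℝ}
    {ℓ : ℕ} (hΔ : unitarityBound3D ℓ < Δ) (hreg : ¬ accidentalDegeneracy3D Δ ℓ) (hab : Δ₁₂ = -Δ₃₄)
    (F : Finset (ℕ × ℕ))
    (hhead : 0 ≤ ∑ q ∈ F, hrCoeffAB (Δ₃₄ / 2) (Δ₃₄ / 2) Δ ℓ q.1 q.2 / legendreLam ℓ *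
      pointFunctional w z zb (crossF s sign (zMono (Δ + (q.1 : ℝ)) q.2)))
    (htail : ∀ q : ℕ × ℕ, q ∉ F → InDescendantRange ℓ q.1 q.2 →
      0 ≤ pointFunctional w z zb (crossF s sign (zMono (Δ + (q.1 : ℝ)) q.2)))
    {g : ℝ → ℝ → ℝ} (hg : IsConformalBlock3D Δ₁₂ Δ₃₄ Δ ℓ g) :
    0 ≤ pointFunctional w z zb (crossF s sign g) := by
  have hS := hasSum_pointFunctional_crossF_hrZAB w z zb hz hzb s sign hΔ hreg hab hg
  refine hhead.trans (sum_le_hasSum F (fun q hq => ?_) hS)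
  by_cases hr : InDescendantRange ℓ q.1 q.2
  · exact mul_nonneg (div_nonneg (hrCoeffAB_self_nonneg _ hΔ _ _) (legendreLam_pos ℓ).le)
      (htail q hq hr)
  · rw [hrCoeffAB_eq_zero_of_not_inDescendantRange _ _ Δ hr, zero_div, zero_mul]

end Literature.MathematicalPhysics.QuantumFieldTheory.ConformalBootstrap3D
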